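import Literature.NumberTheory.Automorphic.AutomorphicRepsGLCuspidalL2Step4
import Literature.NumberTheory.Automorphic.ArchGroupGLCartan
import Literature.NumberTheory.Automorphic.HeckeEigenvectorProjection
import HarnessLib

/-!
# Step 3 of Borel–Jacquet 4.6 for `GL_n`: irreducibility of `V_Π` (Harish-Chandra's correspondence)
(decomposition of `AutomorphicRepsGL.formsOfL2_irreducible`, assembly proved)

Topic `NumberTheory/Automorphic`; sibling file of `AutomorphicRepsGLCuspidalL2`, which records the
architecture of `AutomorphicRepsGL.exists_cuspidalRepData_of_L2` (every irreducible closed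
invariant `Π ≤ L²_cusp(GL_n(𝔸_K) ⧸ A_G GL_n(K), μ)` comes from a cuspidal automorphic representation
datum) as four named facts F1–F4 and proves the assembly; F4 is discharged in
`AutomorphicRepsGLCuspidalL2Step4`. This file treats

* F3, `AutomorphicRepsGL.formsOfL2_irreducible hcpt μ`: for an irreducible closed invariant
  `Π ≤ L²_cusp` the space `V_Π = formsOfL2 hcpt μ Π` (the span of the automorphic forms
  `g ↦ f [g⁻¹]` with `[f] ∈ Π`) has no `(𝔤, K_∞) × GL_n(𝔸_K^∞)`-stable subspace other than `0` and
  `V_Π`.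

In print this is Harish-Chandra's correspondence between closed invariant subspaces of an
admissible representation and the submodules of its module of `K`-finite vectors
(Harish-Chandra 1953, Thm. 5, p. 228, with Lemma 34 and Thm. 6, p. 230; Libine 2012 (Schmid's
course), Thm. 72, Cor. 73, Lemma 74, Cor. 75; Wallach, Thm. 3.4.11; Getz–Hahn 2024, Thm. 4.4.1,
Prop. 4.4.2, Thm. 6.5.2; Bump 1997, Prop. 2.4.5 and Thm. 3.3.4), transplanted to the cuspidal
`Π ≤ L²_cusp(GL_n(𝔸_K) ⧸ A_G GL_n(K))` of Borel–Jacquet 1979, 4.6. Triage: **XL** (analytic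
vectors, admissibility of cuspidal `Π`, `K_∞`-isotypic projectors — none of it in Mathlib). The
file DECOMPOSES F3 along the two directions of Harish-Chandra's Theorem 5 and PROVES the assembly:

* `l2OfForms 𝒢 μ W` (**definition**, any adelic datum): the subspace of `L²(μ)` of the classes
  `[f]` of the square-integrable `f` on the automorphic quotient with `invQuot f = (g ↦ f [g⁻¹]) ∈ W`
  — the passage from a space `W` of functions on `G(𝔸_K)` back to `L²`, inverse to `formsOfL2`
  (`l2OfForms_le_of_le_formsOfL2`: for `W ≤ V_Π` these classes lie in `Π`).
* `AutomorphicRepsGL.formsOfL2_closure_exp_invariant hcpt μ` (**named fact** F3a, the closure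
  direction): for a stable `W ≤ V_Π`, the `L²`-closure of `l2OfForms W` is invariant under
  `R(exp X)` for every `X ∈ 𝔤 = 𝔤𝔩_n(K_∞)`. In print: `U(𝔤) W ⊆ W`; the elements of `W` are
  `K`-finite vectors of the admissible `Π^U`, hence analytic (well-behaved) vectors
  (Harish-Chandra 1953, Lemma 34; Libine Thm. 72), so the matrix coefficients
  `t ↦ ⟪R(exp tX) [φ], u⟫`, `u ⊥ W`, vanish identically (Libine Cor. 73; Harish-Chandra Thm. 5:
  `V = Cl(V')` is `π(G)`-invariant, `G` being generated by `exp 𝔤`).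
  PROVED here from it: invariance under `K_∞` (`W` is `K_∞`-stable), under all of
  `G_∞ = K_∞ exp(𝔭)` by the global Cartan (polar) decomposition of `GL_n(K_∞)`
  (`hasCartanDecomposition_archGroupGL` of `ArchGroupGLCartan`;
  `AutomorphicRepsGL.formsOfL2_closure_arch_invariant_of`), under `GL_n(𝔸_K^∞)` (`W` is
  `GL_n(𝔸_K^∞)`-stable and `invQuot` intertwines), and under all of
  `GL_n(𝔸_K) = G_∞ · GL_n(𝔸_K^∞)` (`AutomorphicRepsGL.formsOfL2_closure_invariant_of`).
* `AutomorphicRepsGL.formsOfL2_mem_of_toLp_mem_closure hcpt μ` (**named fact** F3b, the `K`-finite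
  direction): an element of `V_Π` whose class lies in the closure of `l2OfForms W`, `W ≤ V_Π`
  stable, lies in `W`. In print: `Cl(V') ∩ U' = V'` (Harish-Chandra Thm. 5; Libine Lemma 74,
  `(W̄)_fini = W`): the projector `E = e_Ξ e_U` onto a `K_∞ × U`-type maps `[W]` into itself and
  is continuous, and `E(Π)` is finite-dimensional — admissibility of cuspidal `Π`
  (Harish-Chandra 1953, Thm. 6; Gelfand–Graev–Piatetski-Shapiro; Borel–Jacquet 4.6; Bump
  Thm. 3.3.4; Getz–Hahn Thm. 6.5.2 with Thm. 4.4.1) — so `[W] ∩ E(Π)` is closed.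
* `AutomorphicRepsGL.formsOfL2_irreducible_of` (**proved**, Libine Cor. 75 / Harish-Chandra
  Thm. 5 ⇒ irreducibility): F3a → F3b → `formsOfL2_irreducible hcpt μ`. The closure of
  `l2OfForms W` is a closed invariant subspace of the irreducible `Π` (F3a and the proved parts),
  hence `0` or `Π` (`ClosedSubrep.isTopIrreducible_toContRep_iff`); if `0`, then `W = 0` because
  the class map is injective on `V_Π` (its elements are continuous,
  `IsAutomorphicForm.continuous_gl`, and `μ` charges open sets); if `Π`, every generator of `V_Π`
  has its class in the closure, hence lies in `W` by F3b.
* Consequences (**proved**): `AutomorphicRepsGL.exists_cuspidalRepData_of_L2_of_F1_F2_F3ab`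
  (F1 → F2 → F3a → F3b → `exists_cuspidalRepData_of_L2 hcpt μ`, with F4 discharged in
  `AutomorphicRepsGLCuspidalL2Step4`).

## Design notes

* Both named facts quantify over `Π : CuspidalAutomorphicRepGL n K μ` and stable `W ≤ V_Π`
  exactly as F3 does (hypotheses complete: `[(gl n K).IsAutomorphicMeasure μ]`, the honest datum
  `AutomorphyDatum.gl n K hcpt`); F3b only uses `K_∞`- and level-stability of `W` in print but is
  stated with the full `IsStableSubmodule` hypothesis of the target (weaker statement).
* F3a is stated for the one-parameter subgroups `exp X`, `X ∈ 𝔤`, only, which is where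
  analyticity enters; the `K_∞`-invariance, the finite-adelic invariance (`W` is
  `GL_n(𝔸_K^∞)`-stable and `invQuot` intertwines `R` with right translation,
  `rightRegular_toLp_mem_l2OfForms`), the passage `G_∞ = K_∞ exp(𝔭)` (the polar decomposition
  `hasCartanDecomposition_archGroupGL`, proved in `ArchGroupGLCartan`) and the product
  decomposition `g = (g_∞, 1)(1, g_f)` (`GLn.ofInfinite_toMixed_mul_ofFinite_sndHom`) are proved.
* `ContRepresentation.ClosedSubrep.ofInvariantClosure` (a submodule with invariant closure spans
  the closed subrepresentation `Cl(S)`) is a deliberate dot-notation extension of the tree's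
  `ContRepresentation.ClosedSubrep` (like `inflate`/`restrictLE` of `HeckeEigenvectorProjection`
  and `inter`/`generate` of `DiscreteDecompositionCriterion`), stated for any continuous
  representation; the restriction to `Π` uses the existing `isTopIrreducible_toContRep_iff`.
* Admissibility of cuspidal `Π` is not vendored separately here: no proved step of this file
  consumes it (it is the common input of F1 and F3b in print; the tree's
  `harishChandra_finiteness_gl` is Borel–Jacquet 4.3 (i)).
* Nothing restates `formsOfL2_irreducible`; the target keeps its name and meaning, and its trust
  base becomes `{formsOfL2_closure_exp_invariant, formsOfL2_mem_of_toLp_mem_closure}`.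

## References

* A. Borel, H. Jacquet, *Automorphic forms and automorphic representations*, Proc. Sympos. Pure
  Math. 33 (Corvallis 1977), Part 1 (1979), 189–202, §4.6 [BorelJacquetCorvallis1979]
  (interim key [BorelJacquet1979] in the sibling files; not held — statements cross-checked
  against the sources below).
* A. W. Knapp, *Lie Groups Beyond an Introduction*, 2nd ed. (2002), I.§1, Prop. 1.2 (polar
  decomposition) [Knapp2002].
* Harish-Chandra, *Representations of a semisimple Lie group on a Banach space. I*, Trans. AMS 75
  (1953), 185–243: Lemma 33–34 and Thm. 5 (p. 228), Cor. 1–2 (p. 229), Thm. 6 (p. 230)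
  [HarishChandraTAMS1953] (held; interim key [HarishChandra1953]).
* M. Libine, *Introduction to Representations of Real Semisimple Lie Groups* (Schmid's course),
  arXiv:1212.2578: Thm. 58, Thm. 72, Cor. 73, Lemma 74, Cor. 75 [Libine2012] (held).
* J. R. Getz, H. Hahn, *An Introduction to Automorphic Representations*, GTM 300 (2024): Thm. 4.4.1
  and Prop. 4.4.2 (p. 81), Prop. 4.5.3 (p. 86), Thm. 6.5.2 (p. 121) [GetzHahn2024] (held).
* D. Bump, *Automorphic Forms and Representations* (1997): Prop. 2.4.5, §3.3 (p. 293: `𝒜` is a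
  `GL(n, A_f) × (𝔤_∞, K_∞)`-module, not a `GL(n, A)`-module), Thm. 3.3.4 [Bump1997] (held).
* N. R. Wallach, *Real Reductive Groups I* (1988), Thm. 3.4.10–3.4.11 [WallachRRG1] (not held).
-/

open scoped MatrixGroups Matrix ContDiff Classical
open NumberField NumberField.mixedEmbedding IsDedekindDomain
open _root_.MeasureTheory

noncomputable section

namespace Literature.NumberTheory.Automorphic

/-! ## `L²`-classes of a space of functions on `G(𝔸_K)` -/

section General

variable {K : Type} [Field K] [NumberField K] (𝒢 : AdelicGroupData K)
  (μ : Measure 𝒢.automorphicQuotient)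

/-- The subspace of `L²(G(𝔸_K) ⧸ A_G G(K), μ)` attached to a space `W` of functions on `G(𝔸_K)`:
the classes `[f]` of the square-integrable `f` on the automorphic quotient whose inversion
`invQuot 𝒢 f = (g ↦ f [g⁻¹])` lies in `W` (the dictionary D2 of `AutomorphicForms`, read backwards;
for `W` a space of `K`-finite automorphic forms this is the subspace `U' ⊆ 𝔥` of Harish-Chandra
1953, Thm. 5). Borel–Jacquet 1979, 4.6. [cite: BorelJacquetCorvallis1979, 4.6] -/
def l2OfForms (W : Submodule ℂ (𝒢.Adelic → ℂ)) : Submodule ℂ (𝒢.L2 μ) where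
  carrier := {x | ∃ (f : 𝒢.automorphicQuotient → ℂ) (hf : MemLp f 2 μ),
    hf.toLp f = x ∧ invQuot 𝒢 f ∈ W}
  zero_mem' := ⟨0, MemLp.zero, rfl, by
    have h0 : invQuot 𝒢 (0 : 𝒢.automorphicQuotient → ℂ) = 0 := rfl
    rw [h0]
    exact W.zero_mem⟩
  add_mem' := by
    rintro x y ⟨f, hf, rfl, hfW⟩ ⟨g, hg, rfl, hgW⟩
    refine ⟨f + g, hf.add hg, MemLp.toLp_add hf hg, ?_⟩
    have hadd : invQuot 𝒢 (f + g) = invQuot 𝒢 f + invQuot 𝒢 g := rfl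
    rw [hadd]
    exact W.add_mem hfW hgW
  smul_mem' := by
    rintro c x ⟨f, hf, rfl, hfW⟩
    refine ⟨c • f, hf.const_smul c, MemLp.toLp_const_smul c hf, ?_⟩
    have hsmul : invQuot 𝒢 (c • f) = c • invQuot 𝒢 f := rfl
    rw [hsmul]
    exact W.smul_mem c hfW

variable {𝒢 μ}

/-- Membership in `l2OfForms 𝒢 μ W` (definitional). Borel–Jacquet 1979, 4.6. [cite: BorelJacquetCorvallis1979, 4.6] -/
theorem mem_l2OfForms_iff {W : Submodule ℂ (𝒢.Adelic → ℂ)} {x : 𝒢.L2 μ} :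
    x ∈ l2OfForms 𝒢 μ W ↔ ∃ (f : 𝒢.automorphicQuotient → ℂ) (hf : MemLp f 2 μ),
      hf.toLp f = x ∧ invQuot 𝒢 f ∈ W :=
  Iff.rfl

/-- The class of `f ∈ ℒ²(μ)` lies in `l2OfForms 𝒢 μ W` as soon as `invQuot 𝒢 f ∈ W`.
Borel–Jacquet 1979, 4.6. [cite: BorelJacquetCorvallis1979, 4.6] -/
theorem toLp_mem_l2OfForms {W : Submodule ℂ (𝒢.Adelic → ℂ)} {f : 𝒢.automorphicQuotient → ℂ}
    (hf : MemLp f 2 μ) (hW : invQuot 𝒢 f ∈ W) : hf.toLp f ∈ l2OfForms 𝒢 μ W :=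
  ⟨f, hf, rfl, hW⟩

/-- `l2OfForms 𝒢 μ` is monotone in `W`. [folklore] -/
theorem l2OfForms_mono : Monotone (l2OfForms 𝒢 μ) := by
  rintro W W' hle x ⟨f, hf, rfl, hfW⟩
  exact ⟨f, hf, rfl, hle hfW⟩

/-- `invQuot` is injective: `f` is recovered from `g ↦ f [g⁻¹]` (every point of the quotient is
some `[g⁻¹]`). (D2 dictionary.) [folklore] -/
theorem invQuot_injective (𝒢 : AdelicGroupData K) : Function.Injective (invQuot 𝒢) := by
  intro f g h
  funext q
  obtain ⟨x, rfl⟩ := QuotientGroup.mk_surjective q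
  have := congrFun h x⁻¹
  simp only [invQuot_apply, inv_inv] at this
  exact this

variable [SMulInvariantMeasure 𝒢.Adelic 𝒢.automorphicQuotient μ]

/-- The regular representation on classes: `R(g) [f] = [f (g⁻¹ • ·)]` with
`invQuot 𝒢 (f (g⁻¹ • ·)) = r(g) (invQuot 𝒢 f)` (`invQuot_smul`); hence `R(g) [f] ∈ l2OfForms 𝒢 μ W`
whenever the right translate `r(g) (invQuot 𝒢 f)` lies in `W`. Borel–Jacquet 1979, 4.6 (the
dictionary between `L²` and right translation of automorphic forms). [cite: BorelJacquetCorvallis1979, 4.6] -/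
theorem rightRegular_toLp_mem_l2OfForms {W : Submodule ℂ (𝒢.Adelic → ℂ)}
    {f : 𝒢.automorphicQuotient → ℂ} (hf : MemLp f 2 μ) (g : 𝒢.Adelic)
    (hW : rightTranslation 𝒢 g (invQuot 𝒢 f) ∈ W) :
    𝒢.rightRegular μ g (hf.toLp f) ∈ l2OfForms 𝒢 μ W := by
  rw [AdelicGroupData.rightRegular_apply, DomMulAct.mk_smul_toLp]
  refine ⟨_, _, rfl, ?_⟩
  have h : invQuot 𝒢 (fun y ↦ f (g⁻¹ • y)) = rightTranslation 𝒢 g (invQuot 𝒢 f) :=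
    invQuot_smul 𝒢 f g
  exact h ▸ hW

/-- If `W` is stable under right translation by `g`, then `R(g)` maps `l2OfForms 𝒢 μ W` into
itself. Borel–Jacquet 1979, 4.6. [cite: BorelJacquetCorvallis1979, 4.6] -/
theorem rightRegular_apply_mem_l2OfForms {W : Submodule ℂ (𝒢.Adelic → ℂ)} {g : 𝒢.Adelic}
    (hg : W ≤ W.comap (rightTranslation 𝒢 g)) {x : 𝒢.L2 μ} (hx : x ∈ l2OfForms 𝒢 μ W) :
    𝒢.rightRegular μ g x ∈ l2OfForms 𝒢 μ W := by
  obtain ⟨f, hf, rfl, hfW⟩ := hx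
  exact rightRegular_toLp_mem_l2OfForms hf g (hg hfW)

/-- If `W` is stable under right translation by `g`, then `R(g)` maps the `L²`-closure of
`l2OfForms 𝒢 μ W` into itself (continuity of `R(g)`). Borel–Jacquet 1979, 4.6. [cite: BorelJacquetCorvallis1979, 4.6] -/
theorem rightRegular_apply_mem_closure_l2OfForms {W : Submodule ℂ (𝒢.Adelic → ℂ)} {g : 𝒢.Adelic}
    (hg : W ≤ W.comap (rightTranslation 𝒢 g)) {x : 𝒢.L2 μ}
    (hx : x ∈ (l2OfForms 𝒢 μ W).topologicalClosure) :
    𝒢.rightRegular μ g x ∈ (l2OfForms 𝒢 μ W).topologicalClosure := by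
  have hmaps : Set.MapsTo (𝒢.rightRegular μ g) (l2OfForms 𝒢 μ W : Set (𝒢.L2 μ))
      (l2OfForms 𝒢 μ W : Set (𝒢.L2 μ)) := fun x hx ↦ rightRegular_apply_mem_l2OfForms hg hx
  have hcl := hmaps.closure (𝒢.rightRegular μ g).continuous
  rw [← Submodule.topologicalClosure_coe] at hcl
  exact hcl hx

end General

end Literature.NumberTheory.Automorphic

/-! ## A submodule with invariant closure spans a closed subrepresentation -/

namespace ContRepresentation.ClosedSubrep

variable {R G V : Type*} [Ring R] [Monoid G] [AddCommGroup V] [TopologicalSpace V]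
  [IsTopologicalAddGroup V] [Module R V] [ContinuousConstSMul R V] {π : ContRepresentation R G V}

variable (π) in
/-- The closed subrepresentation `Cl(S)` spanned by a submodule `S` whose closure is invariant
under every `π g` (e.g. an invariant `S`, by continuity of `π g`). Deliberate dot-notation
extension of `ContRepresentation.ClosedSubrep` (cf. `inflate`, `restrictLE`, `generate`).
Dixmier 1977, §13.1.2. [cite: Dixmier1977, §13.1.2] -/
def ofInvariantClosure (S : Submodule R V)
    (hS : ∀ g : G, ∀ v ∈ S.topologicalClosure, π g v ∈ S.topologicalClosure) : ClosedSubrep π where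
  toSubmodule := S.topologicalClosure
  apply_mem_toSubmodule := hS
  isClosed' := S.isClosed_topologicalClosure

/-- The submodule underlying `ofInvariantClosure π S hS` is `Cl(S)` (definitional). [folklore] -/
@[simp]
theorem toSubmodule_ofInvariantClosure (S : Submodule R V)
    (hS : ∀ g : G, ∀ v ∈ S.topologicalClosure, π g v ∈ S.topologicalClosure) :
    (ofInvariantClosure π S hS).toSubmodule = S.topologicalClosure :=
  rfl

/-- Membership in `ofInvariantClosure π S hS` is membership in `Cl(S)` (definitional). [folklore] -/
@[simp]
theorem mem_ofInvariantClosure_iff (S : Submodule R V)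
    (hS : ∀ g : G, ∀ v ∈ S.topologicalClosure, π g v ∈ S.topologicalClosure) {v : V} :
    v ∈ ofInvariantClosure π S hS ↔ v ∈ S.topologicalClosure :=
  Iff.rfl

end ContRepresentation.ClosedSubrep

namespace Literature.NumberTheory.Automorphic

/-! ## The class map on `V_Π`: representatives, continuity, injectivity -/

section GeneralLinear

variable {n : ℕ} {K : Type} [Field K] [NumberField K]
  {hcpt : isCompact_glFiniteIntegralLevel n K}
  {μ : Measure (AdelicGroupData.gl n K).automorphicQuotient}

section Invariant

variable [SMulInvariantMeasure (AdelicGroupData.gl n K).Adelic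
    (AdelicGroupData.gl n K).automorphicQuotient μ]

/-- Every element of `V_Π = formsOfL2 hcpt μ Π` is `invQuot f` for a square-integrable `f` with
`[f] ∈ Π`, and is continuous (its generators are automorphic forms, continuous by
`IsAutomorphicForm.continuous_gl`; `invQuot` and `toLp` are linear).
Borel–Jacquet 1979, 4.2 and 4.6. [cite: BorelJacquetCorvallis1979, 4.2 and 4.6] -/
theorem exists_toLp_mem_of_mem_formsOfL2
    {P : ContRepresentation.ClosedSubrep ((AdelicGroupData.gl n K).rightRegular μ)}
    {φ : (AdelicGroupData.gl n K).Adelic → ℂ} (hφ : φ ∈ formsOfL2 hcpt μ P) :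
    ∃ (f : (AdelicGroupData.gl n K).automorphicQuotient → ℂ) (hf : MemLp f 2 μ),
      hf.toLp f ∈ P ∧ φ = invQuot (AdelicGroupData.gl n K) f ∧ Continuous φ := by
  induction hφ using Submodule.span_induction with
  | mem φ h =>
    obtain ⟨f, hf, hP, rfl, hφ⟩ := h
    exact ⟨f, hf, hP, rfl, hφ.continuous_gl⟩
  | zero =>
    exact ⟨0, MemLp.zero, by rw [MemLp.toLp_zero]; exact P.toSubmodule.zero_mem, rfl,
      continuous_const⟩
  | add φ ψ _ _ h₁ h₂ =>
    obtain ⟨f, hf, hfP, rfl, hcf⟩ := h₁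
    obtain ⟨g, hg, hgP, rfl, hcg⟩ := h₂
    exact ⟨f + g, hf.add hg, by rw [MemLp.toLp_add hf hg]; exact P.toSubmodule.add_mem hfP hgP,
      rfl, hcf.add hcg⟩
  | smul c φ _ h =>
    obtain ⟨f, hf, hfP, rfl, hcf⟩ := h
    exact ⟨c • f, hf.const_smul c,
      by rw [MemLp.toLp_const_smul c hf]; exact P.toSubmodule.smul_mem c hfP, rfl,
      hcf.const_smul c⟩

/-- Elements of `V_Π` are continuous functions on `GL_n(𝔸_K)`. Borel–Jacquet 1979, 4.2. [cite: BorelJacquetCorvallis1979, 4.2] -/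
theorem continuous_of_mem_formsOfL2
    {P : ContRepresentation.ClosedSubrep ((AdelicGroupData.gl n K).rightRegular μ)}
    {φ : (AdelicGroupData.gl n K).Adelic → ℂ} (hφ : φ ∈ formsOfL2 hcpt μ P) : Continuous φ := by
  obtain ⟨-, -, -, -, h⟩ := exists_toLp_mem_of_mem_formsOfL2 hφ
  exact h

/-- For `W ≤ V_Π`, the classes of `W` lie in `Π`: `l2OfForms W ≤ Π` (an element `invQuot f` of
`V_Π` is `invQuot f'` with `[f'] ∈ Π`, and `invQuot` is injective). Borel–Jacquet 1979, 4.6. [cite: BorelJacquetCorvallis1979, 4.6] -/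
theorem l2OfForms_le_of_le_formsOfL2
    {P : ContRepresentation.ClosedSubrep ((AdelicGroupData.gl n K).rightRegular μ)}
    {W : Submodule ℂ ((AdelicGroupData.gl n K).Adelic → ℂ)} (hW : W ≤ formsOfL2 hcpt μ P) :
    l2OfForms (AdelicGroupData.gl n K) μ W ≤ P.toSubmodule := by
  rintro x ⟨f, hf, rfl, hfW⟩
  obtain ⟨f', hf', hP, hff', -⟩ := exists_toLp_mem_of_mem_formsOfL2 (hW hfW)
  obtain rfl : f = f' := invQuot_injective _ hff'
  exact hP

end Invariant

variable [(AdelicGroupData.gl n K).IsAutomorphicMeasure μ]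

/-- **The class map is injective on `V_Π`.** If `invQuot f ∈ V_Π` and `[f] = 0` in `L²(μ)`, then
`f = 0`: `invQuot f`, hence `f`, is continuous, `f = 0` a.e., and an automorphic measure charges
every non-empty open set. Borel–Jacquet 1979, 4.6; Getz–Hahn 2024, Thm. 6.5.2. [cite: BorelJacquetCorvallis1979, 4.6] -/
theorem eq_zero_of_toLp_eq_zero_of_invQuot_mem_formsOfL2
    {P : ContRepresentation.ClosedSubrep ((AdelicGroupData.gl n K).rightRegular μ)}
    {f : (AdelicGroupData.gl n K).automorphicQuotient → ℂ} (hf : MemLp f 2 μ)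
    (hV : invQuot (AdelicGroupData.gl n K) f ∈ formsOfL2 hcpt μ P) (h0 : hf.toLp f = 0) : f = 0 := by
  have hcont : Continuous f := continuous_of_continuous_invQuot (continuous_of_mem_formsOfL2 hV)
  have hae : f =ᵐ[μ] (0 : (AdelicGroupData.gl n K).automorphicQuotient → ℂ) := by
    rw [← MemLp.toLp_eq_toLp_iff hf MemLp.zero, MemLp.toLp_zero]
    exact h0
  exact Measure.eq_of_ae_eq hae hcont continuous_zero

/-! ## The two halves of Harish-Chandra's Theorem 5 for cuspidal `Π` (named facts) -/

variable (hcpt μ) in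
/-- **Step 3a (closure of a stable subspace is invariant under the one-parameter subgroups).**
For an irreducible closed invariant `Π ≤ L²_cusp(GL_n(𝔸_K) ⧸ A_G GL_n(K), μ)`, a
`(𝔤, K_∞) × GL_n(𝔸_K^∞)`-stable subspace `W ≤ V_Π` and `X ∈ 𝔤 = 𝔤𝔩_n(K_∞)`, the `L²`-closure of
the classes of `W` (`l2OfForms W`) is invariant under `R(exp X)`. In print: the elements of `W` are
`K`-finite vectors of the admissible representation `Π^U` of `G_∞`, hence analytic (well-behaved)
vectors (Harish-Chandra 1953, Lemma 34; Libine 2012, Thm. 72), and `U(𝔤) W ⊆ W` (the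
`L²`-derivative along `exp tX` of the class of `φ ∈ W` is the class of the Lie derivative `X φ`),
so for `u ⊥ W` the analytic function `t ↦ ⟪R(exp tX)[φ], u⟫` vanishes with all its derivatives at
`0`, hence identically (Libine 2012, Cor. 73; Harish-Chandra 1953, Thm. 5: `Cl(V')` is
`π(G)`-invariant). For cuspidal `Π` on `G(𝔸)`: Borel–Jacquet 1979, 4.6.
[cite: HarishChandraTAMS1953, Thm. 5 and Lemma 34] [cite: Libine2012, Cor. 73] -/
def AutomorphicRepsGL.formsOfL2_closure_exp_invariant : Prop :=
  ∀ (P : CuspidalAutomorphicRepGL n K μ) (W : Submodule ℂ ((AdelicGroupData.gl n K).Adelic → ℂ)),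
    W ≤ formsOfL2 hcpt μ P.1 → IsStableSubmodule (AutomorphyDatum.gl n K hcpt) W →
      ∀ (X : (AutomorphyDatum.gl n K hcpt).arch.lie),
        ∀ y ∈ (l2OfForms (AdelicGroupData.gl n K) μ W).topologicalClosure,
          (AdelicGroupData.gl n K).rightRegular μ
              ((AutomorphyDatum.gl n K hcpt).ofArch ((AutomorphyDatum.gl n K hcpt).arch.expMem X)) y ∈
            (l2OfForms (AdelicGroupData.gl n K) μ W).topologicalClosure

variable (hcpt μ) in
/-- **Step 3b (`K`-finite vectors in the closure).** For an irreducible closed invariant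
`Π ≤ L²_cusp(GL_n(𝔸_K) ⧸ A_G GL_n(K), μ)`, a `(𝔤, K_∞) × GL_n(𝔸_K^∞)`-stable subspace `W ≤ V_Π`,
and `f ∈ ℒ²(μ)` with `invQuot f ∈ V_Π` whose class `[f]` lies in the `L²`-closure of the classes of
`W`, already `invQuot f ∈ W`. In print (`Cl(V') ∩ U' = V'`, Harish-Chandra 1953, Thm. 5; Libine
2012, Lemma 74, `(W̄)_fini = W`): `[f]` is `K_∞`-finite of level `U`, so `[f] = E [f]` for the
projector `E = e_Ξ e_U` onto finitely many `K_∞`-types `Ξ` and `U`-invariants; `E` is continuous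
and maps the classes of `W` into themselves (`W` is `K_∞`- and `GL_n(𝔸_K^∞)`-stable and consists of
`K`-finite vectors); and `E(Π)` is finite-dimensional — admissibility of cuspidal `Π`
(Harish-Chandra 1953, Thm. 6; Gelfand–Graev–Piatetski-Shapiro; Borel–Jacquet 1979, 4.6; Bump
1997, Thm. 3.3.4; Getz–Hahn 2024, Thm. 6.5.2 with Thm. 4.4.1) — so `[f] ∈ Cl(E[W]) = E[W] ⊆ [W]`,
and the class map is injective on `V_Π`.
[cite: HarishChandraTAMS1953, Thm. 5 and Thm. 6] [cite: Libine2012, Lemma 74] -/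
def AutomorphicRepsGL.formsOfL2_mem_of_toLp_mem_closure : Prop :=
  ∀ (P : CuspidalAutomorphicRepGL n K μ) (W : Submodule ℂ ((AdelicGroupData.gl n K).Adelic → ℂ)),
    W ≤ formsOfL2 hcpt μ P.1 → IsStableSubmodule (AutomorphyDatum.gl n K hcpt) W →
      ∀ (f : (AdelicGroupData.gl n K).automorphicQuotient → ℂ) (hf : MemLp f 2 μ),
        hf.toLp f ∈ (l2OfForms (AdelicGroupData.gl n K) μ W).topologicalClosure →
          invQuot (AdelicGroupData.gl n K) f ∈ formsOfL2 hcpt μ P.1 →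
            invQuot (AdelicGroupData.gl n K) f ∈ W

/-! ## From the one-parameter subgroups to `GL_n(𝔸_K)`-invariance (proved) -/

/-- The closure of the classes of a `K_∞`-stable `W` is `K_∞`-invariant (`W ≤ W ∘ r(k)` and
continuity of `R(k)`; elementary half of Libine 2012, Cor. 73). [folklore] -/
theorem AutomorphicRepsGL.formsOfL2_closure_ofK_invariant
    {W : Submodule ℂ ((AdelicGroupData.gl n K).Adelic → ℂ)}
    (hW : IsStableSubmodule (AutomorphyDatum.gl n K hcpt) W)
    (k : (AutomorphyDatum.gl n K hcpt).arch.maximalCompact) {y : (AdelicGroupData.gl n K).L2 μ}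
    (hy : y ∈ (l2OfForms (AdelicGroupData.gl n K) μ W).topologicalClosure) :
    (AdelicGroupData.gl n K).rightRegular μ ((AutomorphyDatum.gl n K hcpt).ofK k) y ∈
      (l2OfForms (AdelicGroupData.gl n K) μ W).topologicalClosure :=
  rightRegular_apply_mem_closure_l2OfForms (hW.k_stable k) hy

/-- **The closure of the classes of a stable `W ≤ V_Π` is `G_∞`-invariant**, given Step 3a: by
the global Cartan (polar) decomposition `GL_n(K_∞) = K_∞ exp(𝔭)`
(`hasCartanDecomposition_archGroupGL`; Knapp, *Lie Groups Beyond an Introduction*, Prop. 1.2 and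
Thm. 6.31 (c)) `g_∞ = k exp X`, and `R(g_∞) = R(k) R(exp X)` with both factors preserving the
closure (`formsOfL2_closure_ofK_invariant`, Step 3a). Harish-Chandra 1953, Thm. 5; Libine 2012,
Cor. 73. [cite: Libine2012, Cor. 73] -/
theorem AutomorphicRepsGL.formsOfL2_closure_arch_invariant_of
    (h₃a : AutomorphicRepsGL.formsOfL2_closure_exp_invariant hcpt μ)
    (P : CuspidalAutomorphicRepGL n K μ) {W : Submodule ℂ ((AdelicGroupData.gl n K).Adelic → ℂ)}
    (hWV : W ≤ formsOfL2 hcpt μ P.1) (hW : IsStableSubmodule (AutomorphyDatum.gl n K hcpt) W)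
    (x : (AutomorphyDatum.gl n K hcpt).arch.carrier) {y : (AdelicGroupData.gl n K).L2 μ}
    (hy : y ∈ (l2OfForms (AdelicGroupData.gl n K) μ W).topologicalClosure) :
    (AdelicGroupData.gl n K).rightRegular μ ((AutomorphyDatum.gl n K hcpt).ofArch x) y ∈
      (l2OfForms (AdelicGroupData.gl n K) μ W).topologicalClosure := by
  obtain ⟨k, hk, X, hX, -, hx⟩ := hasCartanDecomposition_archGroupGL n K x.1 x.2
  -- `x = k · exp X` inside `G_∞`
  have hx' : x = Subgroup.inclusion (AutomorphyDatum.gl n K hcpt).arch.maximalCompact_le_carrier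
      ⟨k, hk⟩ * (AutomorphyDatum.gl n K hcpt).arch.expMem ⟨X, hX⟩ := by
    refine Subtype.ext ?_
    rw [Subgroup.coe_mul, RealMatrixGroup.coe_expMem]
    exact hx
  rw [hx', map_mul, map_mul]
  exact AutomorphicRepsGL.formsOfL2_closure_ofK_invariant hW ⟨k, hk⟩ (h₃a P W hWV hW ⟨X, hX⟩ y hy)

/-- **The closure of the classes of a stable `W ≤ V_Π` is `GL_n(𝔸_K)`-invariant**, given Step 3a:
`g = (g_∞, 1) · (1, g_f)` (`GLn.ofInfinite_toMixed_mul_ofFinite_sndHom`); `R(1, g_f)` preserves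
the classes of `W` (`W` is `GL_n(𝔸_K^∞)`-stable, `rightRegular_apply_mem_closure_l2OfForms`) and
`R(g_∞, 1)` preserves their closure (`formsOfL2_closure_arch_invariant_of`). Harish-Chandra 1953,
Thm. 5; Libine 2012, Cor. 73; Borel–Jacquet 1979, 4.6. [cite: Libine2012, Cor. 73] -/
theorem AutomorphicRepsGL.formsOfL2_closure_invariant_of
    (h₃a : AutomorphicRepsGL.formsOfL2_closure_exp_invariant hcpt μ)
    (P : CuspidalAutomorphicRepGL n K μ) {W : Submodule ℂ ((AdelicGroupData.gl n K).Adelic → ℂ)}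
    (hWV : W ≤ formsOfL2 hcpt μ P.1) (hW : IsStableSubmodule (AutomorphyDatum.gl n K hcpt) W)
    (g : (AdelicGroupData.gl n K).Adelic) {y : (AdelicGroupData.gl n K).L2 μ}
    (hy : y ∈ (l2OfForms (AdelicGroupData.gl n K) μ W).topologicalClosure) :
    (AdelicGroupData.gl n K).rightRegular μ g y ∈
      (l2OfForms (AdelicGroupData.gl n K) μ W).topologicalClosure := by
  -- the finite part `(1, g_f)` lies in `G(𝔸_f)` and `W` is `G(𝔸_f)`-stable
  have hf : GLn.ofFinite n K (GLn.sndHom n K g) ∈ (AutomorphyDatum.gl n K hcpt).finiteAdelic := by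
    rw [AutomorphyDatum.gl_finiteAdelic]
    exact ⟨_, rfl⟩
  have hyf := rightRegular_apply_mem_closure_l2OfForms (hW.finite_stable _ hf) hy
  -- the archimedean part `(g_∞, 1)` is `ofArch` of `g_∞ ∈ G_∞ = ⊤`
  let x : (AutomorphyDatum.gl n K hcpt).arch.carrier := ⟨GLn.toMixed n K g, Subgroup.mem_top _⟩
  have key : (AdelicGroupData.gl n K).rightRegular μ g =
      (AdelicGroupData.gl n K).rightRegular μ ((AutomorphyDatum.gl n K hcpt).ofArch x) *
        (AdelicGroupData.gl n K).rightRegular μ (GLn.ofFinite n K (GLn.sndHom n K g)) := by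
    rw [← map_mul]
    exact congrArg _ (GLn.ofInfinite_toMixed_mul_ofFinite_sndHom g).symm
  rw [key]
  exact AutomorphicRepsGL.formsOfL2_closure_arch_invariant_of h₃a P hWV hW x hyf

/-! ## The assembly: Harish-Chandra's correspondence gives irreducibility of `V_Π` (proved) -/

/-- **Step 3 of Borel–Jacquet 4.6 from Steps 3a and 3b** (Harish-Chandra 1953, Thm. 5; Libine
2012, Cor. 75): the `(𝔤, K_∞) × GL_n(𝔸_K^∞)`-module `V_Π` of an irreducible closed invariant
`Π ≤ L²_cusp` is irreducible. Given a stable `W ≤ V_Π`, the closure of its classes is a closed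
`GL_n(𝔸_K)`-invariant subspace (`ClosedSubrep.ofInvariantClosure` with
`formsOfL2_closure_invariant_of`) of `Π` (`l2OfForms_le_of_le_formsOfL2`), hence `⊥` or `Π` by
topological irreducibility (`ClosedSubrep.isTopIrreducible_toContRep_iff`). If `⊥`, every `φ ∈ W`
has class `0`, so `φ = 0` (`eq_zero_of_toLp_eq_zero_of_invQuot_mem_formsOfL2`) and `W = ⊥`; if
`Π`, every generator `invQuot f` of `V_Π` (`[f] ∈ Π`) has its class in the closure, hence lies in
`W` by Step 3b, and `W = V_Π`. [cite: Libine2012, Cor. 75] -/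
theorem AutomorphicRepsGL.formsOfL2_irreducible_of
    (h₃a : AutomorphicRepsGL.formsOfL2_closure_exp_invariant hcpt μ)
    (h₃b : AutomorphicRepsGL.formsOfL2_mem_of_toLp_mem_closure hcpt μ) :
    AutomorphicRepsGL.formsOfL2_irreducible hcpt μ := by
  intro P W hWV hW
  -- the closed invariant subspace `Cl[W] ≤ Π`
  let Q : ContRepresentation.ClosedSubrep ((AdelicGroupData.gl n K).rightRegular μ) :=
    ContRepresentation.ClosedSubrep.ofInvariantClosure _ (l2OfForms (AdelicGroupData.gl n K) μ W)
      fun g _ hy ↦ AutomorphicRepsGL.formsOfL2_closure_invariant_of h₃a P hWV hW g hy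
  have hQP : Q ≤ P.1 := ContRepresentation.ClosedSubrep.toSubmodule_le_iff.mp
    (Submodule.topologicalClosure_minimal _ (l2OfForms_le_of_le_formsOfL2 hWV) P.1.isClosed)
  -- it is `⊥` or `Π`
  rcases ((ContRepresentation.ClosedSubrep.isTopIrreducible_toContRep_iff P.1).mp
      P.isTopIrreducible).2 Q hQP with hbot | htop
  · -- `Cl[W] = ⊥`: every element of `W` has class `0`, hence vanishes
    left
    refine (Submodule.eq_bot_iff _).mpr fun φ hφ ↦ ?_
    obtain ⟨f, hf, -, rfl, -⟩ := exists_toLp_mem_of_mem_formsOfL2 (hWV hφ)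
    have hmem : hf.toLp f ∈ Q := (ContRepresentation.ClosedSubrep.mem_ofInvariantClosure_iff _ _).mpr
      (Submodule.le_topologicalClosure _ (toLp_mem_l2OfForms hf hφ))
    rw [hbot, ContRepresentation.ClosedSubrep.mem_bot] at hmem
    have hf0 : f = 0 := eq_zero_of_toLp_eq_zero_of_invQuot_mem_formsOfL2 hf (hWV hφ) hmem
    subst hf0
    rfl
  · -- `Cl[W] = Π`: every generator of `V_Π` has its class in `Cl[W]`, hence lies in `W`
    right
    refine le_antisymm hWV (Submodule.span_le.mpr ?_)
    rintro φ ⟨f, hf, hfP, rfl, hφ⟩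
    have hmem : hf.toLp f ∈ Q := by
      rw [htop]
      exact hfP
    exact h₃b P W hWV hW f hf ((ContRepresentation.ClosedSubrep.mem_ofInvariantClosure_iff _ _).mp hmem)
      (invQuot_mem_formsOfL2 hf hfP hφ)

/-- **Borel–Jacquet 4.6 for `GL_n` from F1, F2, F3a, F3b** (F4 being discharged in
`AutomorphicRepsGLCuspidalL2Step4`): non-vanishing and stability of `V_Π` together with the two
halves of Harish-Chandra's correspondence give `exists_cuspidalRepData_of_L2 hcpt μ` — every
irreducible closed invariant `Π ≤ L²_cusp` comes from the cuspidal automorphic representation datum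
`V_Π / 0`. Borel–Jacquet 1979, 4.6. [cite: BorelJacquetCorvallis1979, 4.6] -/
theorem AutomorphicRepsGL.exists_cuspidalRepData_of_L2_of_F1_F2_F3ab
    (h₁ : AutomorphicRepsGL.formsOfL2_ne_bot hcpt μ)
    (h₂ : AutomorphicRepsGL.formsOfL2_isStableSubmodule hcpt μ)
    (h₃a : AutomorphicRepsGL.formsOfL2_closure_exp_invariant hcpt μ)
    (h₃b : AutomorphicRepsGL.formsOfL2_mem_of_toLp_mem_closure hcpt μ) :
    AutomorphicRepsGL.exists_cuspidalRepData_of_L2 hcpt μ :=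
  AutomorphicRepsGL.exists_cuspidalRepData_of_L2_of_three h₁ h₂
    (AutomorphicRepsGL.formsOfL2_irreducible_of h₃a h₃b)

end GeneralLinear

end Literature.NumberTheory.Automorphic
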